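import Literature.AlgebraicGeometry.Motives.CechPseudoCoherentAtGrauert
import Literature.AlgebraicGeometry.Motives.AbelianVarietyTheoremOfCubeProofs
import HarnessLib

/-!
# The Theorem of the Cube from the pseudo-coherence of the Čech complexes of ONE proper scheme
# (Görtz–Wedhorn II, Lemma 24.72, Thm. 24.73, Prop. 27.167, Prop. 27.184 (1))

Third file of the re-threading, one proper scheme at a time, of the cohomological chain behind the
Theorem of the Cube (`Motives/CechPseudoCoherentAt`, `Motives/CechPseudoCoherentAtGrauert`). The
global chain of `Motives/AbelianVarietyTheoremOfCubeProofs` proves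
`theoremOfCube_linEquiv_of_pseudoCoherent_general : cechComplex_pseudoCoherent_general → theoremOfCube_linEquiv`,
the hypothesis quantifying over ALL proper `K`-schemes (finiteness of coherent cohomology of proper
morphisms, Chow's lemma). Following the printed proof of Thm. 24.73 (p. 550: Thm. 24.66 and
Lemma 24.72 are applied to the one morphism `f : X ×_S Y ×_S T → T`), this file proves the Theorem
of the Cube for `(X, Y, T)` from `CechPseudoCoherentAt (X ⊗ Y)` alone, and draws the consequences
for an abelian variety `A` from `CechPseudoCoherentAt (A ⊗ A)` alone — so that, `A` being projective
(`AbelianVariety.isProjectiveOver_holds`, `Motives/AbelianVarietyProjectiveChart`), Serre's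
finiteness theorem for the line bundles `𝒪(D)` on the closed subschemes `(A × A) ×_K T₀ ⊆ 𝐏ⁿ_{T₀}`
suffices (`AbelianVariety.pullback_zsmul_id_linEquiv_of_finite_cechCohomology`). The proofs are
those of the global chain, specialised:

* `CechPseudoCoherentAt.sectionAlong` — Cor. 23.137 in degree `0` for `𝒪(D)` on `P ×_K T → T`,
  naturally in affine `T`-schemes (the statement of `grothendieckComplex_sectionAlong` at `P`; proof
  of `grothendieckComplex_sectionAlong_of_cech` with `cechComplex_h0_sectionAlong_holds`);
* `CechPseudoCoherentAt.formalFunctions` — the theorem on formal functions for `H⁰` of `𝒪(D)`,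
  Thm. 24.42 with (24.8.1) (statement of `formalFunctions_exists_isSectionOver_restrict` at `P`; proof
  of `formalFunctions_exists_isSectionOver_restrict_of_grothendieckComplex_sectionAlong`);
* `CechPseudoCoherentAt.isTrivialOver_nhds_of_trivialAlong_thickeningPt` — Lemma 24.72, Step (II)
  (statement of `isTrivialOver_nhds_of_trivialAlong_thickeningPt` at `P`; proof of
  `isTrivialOver_nhds_of_trivialAlong_thickeningPt_of_formalFunctions`);
* `CechPseudoCoherentAt.isTrivialOver_nhds`, `…exists_isSectionOver`, `…isOpen_trivialLocus` —
  Lemma 24.72 for `𝒪(D)` on `(X × Y) × T → T` over an arbitrary integral base, with Step (I)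
  (`theoremOfCube_trivialAlong_thickeningPt_holds`, `Motives/CubeStepI`) and noetherian descent
  (`theoremOfCube_noetherianDescent_holds`, `Motives/TheoremOfCubeLimitProofs`), both theorems;
* `theoremOfCube_linEquiv_of_cechPseudoCoherentAt` — **the Theorem of the Cube, Görtz–Wedhorn II,
  Thm. 24.73, for `(X, Y, T)` from `CechPseudoCoherentAt (X ⊗ Y)`** (proof of
  `theoremOfCube_linEquiv_of_seesaw`);
* `AbelianVariety.cubicalStructure_linEquiv_of_cechPseudoCoherentAt`,
  `AbelianVariety.pullback_zsmul_id_linEquiv_of_cechPseudoCoherentAt` — Prop. 27.167 and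
  Prop. 27.184 (1) for `A` from `CechPseudoCoherentAt (A ⊗ A)` (proof of
  `AbelianVariety.cubicalStructure_linEquiv_of_theoremOfCube`);
* `AbelianVariety.pullback_zsmul_id_linEquiv_of_finite_cechCohomology` — **`[n]^*D ∼ (n²+n)/2 D +
  (n²−n)/2 [-1]^*D` for `A` from the finiteness of the Čech cohomology of the `𝒪(D₀)` on
  `(A × A) ×_K T₀` for ONE Čech cover each**, `T₀` affine integral of finite type over `K`
  (`cechPseudoCoherentAt_of_exists_cechCover`): the remaining input is Serre's finiteness theorem
  (Görtz–Wedhorn II, Thm. 23.4) for these line bundles on a projective scheme.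

No named facts are introduced; nothing new is claimed mathematically. Mathlib searched (pin): no
theorem of the cube, no coherent cohomology.

## References

* U. Görtz, T. Wedhorn, *Algebraic Geometry II: Cohomology of Schemes*, Springer Spektrum (2023),
  doi:10.1007/978-3-658-43031-3: Cor. 23.137, p. 480; Lemma 24.40, p. 527; Thm. 24.42 with (24.8.1),
  p. 529; Thm. 24.66, pp. 542–546; Lemma 24.72 and its proof, Steps (I)–(II), pp. 548–549;
  Thm. 24.73 and its proof, p. 550; Prop. 27.167, pp. 877–878; Prop. 27.184 (1), Rem. 27.185, p. 886
  (read via the held copy). [GortzWedhorn2023]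
* D. Mumford, *Abelian Varieties*, TIFR Studies in Mathematics 5 (1970), §5, §6. [MumfordAV1970]
-/

universe u

open CategoryTheory CategoryTheory.Limits AlgebraicGeometry MonoidalCategory TopologicalSpace
open CartesianMonoidalCategory Opposite TensorProduct
open scoped Matrix
open Literature.AlgebraicGeometry.Motives.RatFn

noncomputable section

namespace Literature.AlgebraicGeometry.Motives

variable {K : Type u} [Field K]

namespace CechPseudoCoherentAt

/-! ### Cor. 23.137 in degree `0`, naturally in affine `T`-schemes, for a fixed `P` -/

set_option maxHeartbeats 1600000 in
/-- **Görtz–Wedhorn II, Cor. 23.137 in degree `0` for `𝒪(D)` on `P ×_K T → T`, for all affine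
`T`-schemes, for a fixed `P` with pseudo-coherent Čech complexes** (the statement of the named fact
`grothendieckComplex_sectionAlong` of `Motives/GrothendieckComplexSectionAlong` at `P`). The proof of
`grothendieckComplex_sectionAlong_of_cech` (`Motives/GrothendieckComplexSectionAlongCech`): around `t₀`
an affine open `V` and a Čech cover `𝔚` of `pr_T⁻¹V`; a strictly perfect model `ψ : Q → Č•`
(`exists_perfect`); the matrix `M` of `d⁰_Q` computes `Ker(d⁰_Q ⊗ B)` naturally in `B`
(`exists_matrix_kerEquiv_baseChange_natural`); `Ker(d⁰_Q ⊗ B) ≅ Ker(d⁰_Č ⊗ B)` naturally (Mumford's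
Lemma 2, `kerZeroBaseChangeMap_bijective`); and `Ker(d⁰_Č ⊗ B) ≅ H⁰(P ⊗ S, (P ◁ g)^*𝒪(D))`
naturally (`cechComplex_h0_sectionAlong_holds`).
[cite: GortzWedhorn2023, Cor. 23.137 with Thm. 23.133, proof, and Cor. 23.135 (pp. 478–480)] -/
theorem sectionAlong {P : SchemeOver K} [IsProper P.hom] (hP : CechPseudoCoherentAt P)
    (T : SchemeOver K) [IsLocallyNoetherian T.left] [IsIntegral (P ⊗ T).left]
    (D : CartierDivisor (P ⊗ T).left) (t₀ : T.left) :
    ∃ (V : T.left.Opens) (_ : t₀ ∈ V) (_ : IsAffineOpen V) (m n : ℕ)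
      (d : Matrix (Fin n) (Fin m) Γ(T.left, V))
      (Φ : ∀ (S : SchemeOver K) [IsAffine S.left] (g : S ⟶ T)
        (hg : (⊤ : S.left.Opens) ≤ g.left ⁻¹ᵁ V),
        D.SectionAlong (P ◁ g).left ≃+
          LinearMap.ker (d.map (g.left.appLE V ⊤ hg).hom).mulVecLin),
      (∀ (S : SchemeOver K) [IsAffine S.left] (g : S ⟶ T) (hg : (⊤ : S.left.Opens) ≤ g.left ⁻¹ᵁ V)
          (b : Γ(S.left, ⊤)) (σ : D.SectionAlong (P ◁ g).left),
        (Φ S g hg (σ.scale ((snd P S).left.appTop b)) : Fin m → Γ(S.left, ⊤)) =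
          b • (Φ S g hg σ : Fin m → Γ(S.left, ⊤))) ∧
      (∀ (S S' : SchemeOver K) [IsAffine S.left] [IsAffine S'.left] (g : S ⟶ T) (g' : S' ⟶ T)
          (h : S' ⟶ S) (hh : h ≫ g = g') (hg : (⊤ : S.left.Opens) ≤ g.left ⁻¹ᵁ V)
          (hg' : (⊤ : S'.left.Opens) ≤ g'.left ⁻¹ᵁ V) (σ : D.SectionAlong (P ◁ g).left) (i : Fin m),
        (Φ S' g' hg' (σ.restrict (P ◁ h).left (whiskerLeft_left_comp_of_eq P hh)) :
            Fin m → Γ(S'.left, ⊤)) i =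
          h.left.appTop ((Φ S g hg σ : Fin m → Γ(S.left, ⊤)) i)) := by
  -- an affine open `V ∋ t₀` and a Čech cover of `pr_T⁻¹V`
  obtain ⟨V, hVaff, ht₀V, -⟩ := (Opens.isBasis_iff_nbhd.1 T.left.isBasis_affineOpens)
    (show t₀ ∈ (⊤ : T.left.Opens) from trivial)
  haveI : Nonempty ↥P.left := nonempty_left_of_nonempty_tensor P T
  have hξ := genericPoint_mem_preimage_snd P T ht₀V
  haveI := quasiCompact_snd_left P T
  obtain ⟨𝔚⟩ := CartierDivisor.CechCover.nonempty (snd P T).left V D hVaff hξ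
  -- Steps (I)–(III): a strictly perfect model `ψ : Q → Č•` in degrees `[0, r]`
  haveI : 𝔚.complex.IsStrictlyLE 𝔚.r := 𝔚.isStrictlyLE_complex
  haveI : 𝔚.complex.IsStrictlyGE 0 := 𝔚.isStrictlyGE_complex
  haveI := flat_snd_left P T
  haveI := isSeparated_snd_left P T
  have hCflat : ∀ n, Module.Flat Γ(T.left, V) (𝔚.complex.X n) := fun n => 𝔚.flat_complex_X hVaff n
  obtain ⟨Q, ψ, hψ, hGE, hLE, hQ⟩ := hP.exists_perfect T D V hVaff 𝔚
  haveI := hψ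
  haveI := hGE
  haveI := hLE
  haveI := (hQ 0).1
  haveI := (hQ 0).2
  haveI := (hQ 1).1
  haveI := (hQ 1).2
  have hQflat : ∀ n, Module.Flat Γ(T.left, V) (Q.X n) := fun n => by
    haveI := (hQ n).2
    infer_instance
  -- the matrix of `d⁰_Q` with its natural kernel isomorphisms `ε_B : Ker(M ⊗ B) ≅ Ker(d⁰_Q ⊗ B)`
  obtain ⟨m, n, M, ε, hε⟩ := exists_matrix_kerEquiv_baseChange_natural (Q.d 0 1).hom
  -- `θ_B : Ker(d⁰_Q ⊗ B) ≅ Ker(d⁰_Č ⊗ B)`, `v ↦ (ψ⁰ ⊗ B) v` (Mumford's Lemma 2, `H⁰ = Ker d⁰`)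
  obtain ⟨θ, hθ⟩ : ∃ θ : ∀ (B : Type u) [CommRing B] [Algebra Γ(T.left, V) B],
      LinearMap.ker ((Q.d 0 1).hom.baseChange B) ≃ₗ[B]
        LinearMap.ker ((𝔚.complex.d 0 1).hom.baseChange B),
      ∀ (B : Type u) [CommRing B] [Algebra Γ(T.left, V) B]
        (x : LinearMap.ker ((Q.d 0 1).hom.baseChange B)),
        (θ B x : B ⊗[Γ(T.left, V)] (𝔚.complex.X 0)) =
          Literature.Algebra.Homology.kerZeroBaseChangeMap ψ B x :=
    ⟨fun B _ _ => LinearEquiv.ofBijective _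
        (Literature.Algebra.Homology.kerZeroBaseChangeMap_bijective ψ B hQflat hCflat 𝔚.r),
      fun B _ _ x => rfl⟩
  -- the Čech identification `Ψ_g : H⁰(P ⊗ S, (P ◁ g)^*𝒪(D)) ≅ Ker(d⁰_Č ⊗ B)`
  obtain ⟨Ψ, hΨlin, hΨnat⟩ := cechComplex_h0_sectionAlong_holds K P T D V hVaff 𝔚
  -- the isomorphisms `Φ_g = ε_B⁻¹ ∘ θ_B⁻¹ ∘ Ψ_g`
  obtain ⟨Φ, hΦ⟩ : ∃ Φ : ∀ (S : SchemeOver K) [IsAffine S.left] (g : S ⟶ T)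
      (hg : (⊤ : S.left.Opens) ≤ g.left ⁻¹ᵁ V),
      D.SectionAlong (P ◁ g).left ≃+
        LinearMap.ker (M.map (g.left.appLE V ⊤ hg).hom).mulVecLin,
      ∀ (S : SchemeOver K) [IsAffine S.left] (g : S ⟶ T) (hg : (⊤ : S.left.Opens) ≤ g.left ⁻¹ᵁ V)
        (x : D.SectionAlong (P ◁ g).left),
        letI := overAlgebra g hg
        Φ S g hg x = (ε Γ(S.left, ⊤)).symm ((θ Γ(S.left, ⊤)).symm (Ψ S g hg x)) :=
    ⟨fun S _ g hg =>
      letI := overAlgebra g hg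
      (Ψ S g hg).trans (((θ Γ(S.left, ⊤)).symm.trans (ε Γ(S.left, ⊤)).symm).toAddEquiv),
      fun S _ g hg x => rfl⟩
  refine ⟨V, ht₀V, hVaff, m, n, M, Φ, ?_, ?_⟩
  · -- `Γ(S, 𝒪_S)`-linearity (all three pieces are `B`-linear); rewriting is done in hypotheses
    intro S _ g hg b σ
    letI := overAlgebra g hg
    have e1 := map_smul (θ Γ(S.left, ⊤)).symm b (Ψ S g hg σ)
    have e2 := map_smul (ε Γ(S.left, ⊤)).symm b ((θ Γ(S.left, ⊤)).symm (Ψ S g hg σ))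
    have k1 := hΦ S g hg (σ.scale ((snd P S).left.appTop b))
    rw [hΨlin S g hg b σ, e1, e2] at k1
    have k3 := congrArg (fun v => ((b • v : LinearMap.ker (M.map
      (algebraMap Γ(T.left, V) Γ(S.left, ⊤))).mulVecLin) : Fin m → Γ(S.left, ⊤))) (hΦ S g hg σ)
    have k4 := congrArg (fun v => ((v : LinearMap.ker (M.map
      (algebraMap Γ(T.left, V) Γ(S.left, ⊤))).mulVecLin) : Fin m → Γ(S.left, ⊤))) k1
    simp only at k3 k4
    exact (k4.trans k3.symm).trans (Submodule.coe_smul _ _)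
  · -- naturality in `(S, g)`
    intro S S' _ _ g g' h hh hg hg' σ i
    letI := overAlgebra g hg
    letI := overAlgebra g' hg'
    let u := pullbackAlgHom g g' h hh hg hg'
    -- the candidate `u ∘ Φ_g σ ∈ Ker(M ⊗ B')`
    let w : LinearMap.ker (M.map (algebraMap Γ(T.left, V) Γ(S'.left, ⊤))).mulVecLin :=
      ⟨fun j => u ((Φ S g hg σ : Fin m → Γ(S.left, ⊤)) j), comp_mem_ker_mulVecLin_map u M _⟩
    -- `θ_B (ε_B (Φ_g σ)) = Ψ_g σ`
    have hθv : θ Γ(S.left, ⊤) (ε Γ(S.left, ⊤) (Φ S g hg σ)) = Ψ S g hg σ := by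
      rw [hΦ S g hg σ, LinearEquiv.apply_symm_apply, LinearEquiv.apply_symm_apply]
    -- `θ_{B'} (ε_{B'} w) = (u ⊗ 1) (θ_B (ε_B (Φ_g σ)))` by the naturality of `ε` and `θ`
    have a3 : (θ Γ(S'.left, ⊤) (ε Γ(S'.left, ⊤) w) :
        Γ(S'.left, ⊤) ⊗[Γ(T.left, V)] (𝔚.complex.X 0)) =
        u.toLinearMap.rTensor (𝔚.complex.X 0)
          (θ Γ(S.left, ⊤) (ε Γ(S.left, ⊤) (Φ S g hg σ)) :
            Γ(S.left, ⊤) ⊗[Γ(T.left, V)] (𝔚.complex.X 0)) := by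
      rw [hθ, hθ]
      exact Literature.Algebra.Homology.rTensor_kerZeroBaseChangeMap ψ _ u _ _
        (hε _ _ u (Φ S g hg σ) w fun j => rfl)
    -- hence `Ψ_{g'}(σ|) = θ_{B'} (ε_{B'} w)` and `Φ_{g'}(σ|) = w`
    have a4 : Ψ S' g' hg' (σ.restrict (P ◁ h).left (whiskerLeft_left_comp_of_eq P hh)) =
        θ Γ(S'.left, ⊤) (ε Γ(S'.left, ⊤) w) :=
      Subtype.ext ((hΨnat S S' g g' h hh hg hg' σ).trans
        (((congrArg (u.toLinearMap.rTensor (𝔚.complex.X 0))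
          (congrArg Subtype.val hθv)).symm).trans a3.symm))
    have hvw : Φ S' g' hg' (σ.restrict (P ◁ h).left (whiskerLeft_left_comp_of_eq P hh)) = w := by
      rw [hΦ S' g' hg', a4, LinearEquiv.symm_apply_apply, LinearEquiv.symm_apply_apply]
    have final := congrArg
      (fun v : LinearMap.ker (M.map (g'.left.appLE V ⊤ hg').hom).mulVecLin =>
        (v : Fin m → Γ(S'.left, ⊤)) i) hvw
    exact final

/-! ### The theorem on formal functions for `H⁰` of `𝒪(D)` and Step (II) of Lemma 24.72, for a fixed `P` -/

/-- **The theorem on formal functions in degree `0` for `𝒪(D)` on `pr_T : P ×_K T → T`, `T` locally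
noetherian, for a fixed `P` with pseudo-coherent Čech complexes** (Görtz–Wedhorn II, Thm. 24.42 with
(24.8.1); the statement of the named fact `formalFunctions_exists_isSectionOver_restrict` of
`Motives/TheoremOfCubeFormalLift` at `P`): for every compatible family `σ_k ∈ H⁰(X_k, 𝒪(D)|_{X_k})`
on the thickenings `X_k = P ×_K Spec(𝒪_{T,t}/𝔪^{k+1})` and every `n`, some section of `𝒪(D)` over some
`pr_T⁻¹U`, `U ∋ t`, restricts to `σ_n`. The proof of
`formalFunctions_exists_isSectionOver_restrict_of_grothendieckComplex_sectionAlong`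
(`Motives/TheoremOfCubeFormalLiftProofs`): Cor. 23.137 near `t` (`sectionAlong`), Artin–Rees in
`𝒪_{T,t}` (`exists_mulVec_eq_zero_of_compatible`, Lemma 24.40), spreading out to an affine `U ∋ t`
(`exists_affineOpen_mulVec_eq_zero_of_germ`) and naturality along `Spec(𝒪_{T,t}/𝔪^{n+1}) → U`.
[cite: GortzWedhorn2023, Thm. 24.42 with (24.8.1) (p. 529), via Cor. 23.137 (p. 480) and Lemma 24.40 (p. 527)] -/
theorem formalFunctions {P : SchemeOver K} [IsProper P.hom] (hP : CechPseudoCoherentAt P)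
    (T : SchemeOver K) [IsLocallyNoetherian T.left] [IsIntegral (P ⊗ T).left]
    (D : CartierDivisor (P ⊗ T).left) (t : T.left)
    (σ : ∀ n, D.SectionAlong (P ◁ thickeningPtι T t n).left) (hσ : D.IsCompatibleFamily t σ)
    (n : ℕ) :
    ∃ (U : T.left.Opens) (htU : t ∈ U) (s : (P ⊗ T).left.functionField)
      (hs : D.IsSectionOver (snd P T).left U s), hs.restrictThickening htU n = σ n := by
  -- Cor. 23.137 near `t`
  obtain ⟨V, htV, -, m, n', d, Φ, -, hnat⟩ := hP.sectionAlong T D t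
  have hg : ∀ k, (⊤ : (thickeningPt T t k).left.Opens) ≤ (thickeningPtι T t k).left ⁻¹ᵁ V :=
    fun k => top_le_preimage_thickeningPtι T t htV k
  -- the compatible family in `Ker(d ⊗ 𝒪_{T,t}/𝔪^{k+1})`
  let R : Type u := T.left.presheaf.stalk t
  let 𝔪 : Ideal R := IsLocalRing.maximalIdeal R
  let v := fun k => Φ (thickeningPt T t k) (thickeningPtι T t k) (hg k) (σ k)
  let w : ∀ k : ℕ, Fin m → stalkModPow T t k := fun k i => (thickeningΓIso T t k).hom.hom ((v k).1 i)
  have hφ : ∀ (k) (a : Γ(T.left, V)),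
      (thickeningΓIso T t k).hom.hom (((thickeningPtι T t k).left.appLE V ⊤ (hg k)).hom a) =
        (stalkModPowMk T t k).hom ((T.left.presheaf.germ V t htV).hom a) := fun k a => by
    have h := appLE_thickeningPtι_left T t k V htV (hg k) a
    change ((thickeningPtι T t k).left.appLE V ⊤ (hg k)).hom a = _ at h
    rw [h]
    exact (thickeningΓIso T t k).inv_hom_id_apply _
  have hw : ∀ k, ((d.map (T.left.presheaf.germ V t htV).hom).map (stalkModPowMk T t k).hom) *ᵥ
      w k = 0 := by
    intro k
    have h1 : (d.map ((thickeningPtι T t k).left.appLE V ⊤ (hg k)).hom) *ᵥ (v k).1 = 0 := by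
      have h := (v k).2
      rwa [LinearMap.mem_ker, Matrix.mulVecLin_apply] at h
    funext j
    have h2 := congrArg (fun x => (thickeningΓIso T t k).hom.hom x) (congrFun h1 j)
    simp only [Pi.zero_apply, map_zero] at h2
    rw [RingHom.map_mulVec, Matrix.map_map] at h2
    have h3 : (⇑(thickeningΓIso T t k).hom.hom ∘ ⇑((thickeningPtι T t k).left.appLE V ⊤ (hg k)).hom) =
        ⇑(stalkModPowMk T t k).hom ∘ ⇑(T.left.presheaf.germ V t htV).hom :=
      funext (hφ k)
    rw [h3, ← Matrix.map_map] at h2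
    exact h2
  have hcompat : ∀ k i, stalkModPowTransitionHom T t k (w (k + 1) i) = w k i := by
    intro k i
    have h1 := hnat (thickeningPt T t (k + 1)) (thickeningPt T t k) (thickeningPtι T t (k + 1))
      (thickeningPtι T t k) (thickeningPtTransition T t k) (thickeningPtTransition_comp T t k)
      (hg (k + 1)) (hg k) (σ (k + 1)) i
    rw [hσ k] at h1
    have h1' : (v k).1 i = ((thickeningPtTransition T t k).left.appTop).hom ((v (k + 1)).1 i) := h1
    obtain ⟨x, hx⟩ : ∃ x, (v (k + 1)).1 i = (thickeningΓIso T t (k + 1)).inv.hom x :=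
      ⟨_, ((thickeningΓIso T t (k + 1)).hom_inv_id_apply _).symm⟩
    change stalkModPowTransitionHom T t k ((thickeningΓIso T t (k + 1)).hom.hom ((v (k + 1)).1 i)) =
      (thickeningΓIso T t k).hom.hom ((v k).1 i)
    rw [h1', hx]
    have h4 := appTop_thickeningPtTransition_left T t k x
    change ((thickeningPtTransition T t k).left.appTop).hom ((thickeningΓIso T t (k + 1)).inv.hom x) =
      (thickeningΓIso T t k).inv.hom (stalkModPowTransitionHom T t k x) at h4
    rw [h4]
    have h5 : (thickeningΓIso T t (k + 1)).hom.hom ((thickeningΓIso T t (k + 1)).inv.hom x) = x :=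
      (thickeningΓIso T t (k + 1)).inv_hom_id_apply x
    have h6 : (thickeningΓIso T t k).hom.hom ((thickeningΓIso T t k).inv.hom
        (stalkModPowTransitionHom T t k x)) = stalkModPowTransitionHom T t k x :=
      (thickeningΓIso T t k).inv_hom_id_apply _
    rw [h5, h6]
  -- Artin–Rees in the noetherian local ring `𝒪_{T,t}`: lift the level `n`
  obtain ⟨vR, hvR, hvRn⟩ := exists_mulVec_eq_zero_of_compatible 𝔪
    (d.map (T.left.presheaf.germ V t htV).hom) w hw hcompat n
  -- spread the lift out to an affine open `U ∋ t`
  obtain ⟨U, hUaff, htU, hUV, a, ha, hda⟩ := exists_affineOpen_mulVec_eq_zero_of_germ htV d vR hvR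
  -- the section of `𝒪(D)` along `P × U → P × T` with coordinates `a`
  haveI : IsAffine (openOver T U).left := isAffine_openOver_left T hUaff
  have hgU : (⊤ : (openOver T U).left.Opens) ≤ (openOverι T U).left ⁻¹ᵁ V :=
    top_le_preimage_openOverι T hUV
  have eU : (⊤ : (openOver T U).left.Opens) ≤ (openOverι T U).left ⁻¹ᵁ U :=
    top_le_preimage_openOverι T le_rfl
  let a'' : Fin m → Γ((openOver T U).left, ⊤) := fun i => (openOverι T U).left.appLE U ⊤ eU (a i)
  have ha'' : a'' ∈ LinearMap.ker (d.map ((openOverι T U).left.appLE V ⊤ hgU).hom).mulVecLin := by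
    rw [LinearMap.mem_ker, Matrix.mulVecLin_apply]
    have e1 : ((openOverι T U).left.appLE V ⊤ hgU).hom =
        ((openOverι T U).left.appLE U ⊤ eU).hom.comp (T.left.presheaf.map (homOfLE hUV).op).hom := by
      rw [← CommRingCat.hom_comp, Scheme.Hom.map_appLE]
    rw [e1, RingHom.coe_comp, ← Matrix.map_map]
    change (d.map ⇑(T.left.presheaf.map (homOfLE hUV).op).hom).map
        ⇑((openOverι T U).left.appLE U ⊤ eU).hom *ᵥ
          (⇑((openOverι T U).left.appLE U ⊤ eU).hom ∘ a) = 0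
    funext j
    rw [Pi.zero_apply, ← RingHom.map_mulVec, hda, Pi.zero_apply, map_zero]
  set σU := (Φ (openOver T U) (openOverι T U) hgU).symm ⟨a'', ha''⟩ with hσU
  have hΦσU : Φ (openOver T U) (openOverι T U) hgU σU = ⟨a'', ha''⟩ := by
    rw [hσU, AddEquiv.apply_symm_apply]
  -- it is a rational section `s` of `𝒪(D)` over `pr_T⁻¹U`
  have hne : genericPoint (P ⊗ T).left ∈ (snd P T).left ⁻¹ᵁ U := by
    haveI : Nonempty P.left := nonempty_of_nonempty_tensor_left P T
    haveI := surjective_hom_of_nonempty P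
    obtain ⟨y, hy⟩ := (snd P T).left.surjective t
    refine genericPoint_mem_of_mem (x := y) ?_
    change (snd P T).left y ∈ U
    rw [hy]; exact htU
  obtain ⟨s, hs, hsσ⟩ := CartierDivisor.SectionAlong.exists_isSectionOver_ofRegular_eq D hne σU
  refine ⟨U, htU, s, hs, ?_⟩
  -- `s|_{X_n} = σ_n`: restrict `σU` along `S_n → U`, use naturality and injectivity on `S_n`
  have hrestr : σU.restrict (P ◁ thickeningPtToOpen htU n).left
      (whiskerLeft_left_comp_of_eq P (thickeningPtToOpen_comp htU n)) = hs.restrictThickening htU n := by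
    rw [← hsσ, CartierDivisor.SectionAlong.ofRegular_restrict _ _ _ _
      (whiskerLeft_thickeningPtι_apply_mem_preimage htU n)]
  apply (Φ (thickeningPt T t n) (thickeningPtι T t n) (hg n)).injective
  rw [← hrestr]
  apply Subtype.ext
  funext i
  rw [hnat (openOver T U) (thickeningPt T t n) (openOverι T U) (thickeningPtι T t n)
    (thickeningPtToOpen htU n) (thickeningPtToOpen_comp htU n) hgU (hg n) σU i, hΦσU]
  change (thickeningPtToOpen htU n).left.appTop ((openOverι T U).left.appLE U ⊤ eU (a i)) =
    (v n).1 i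
  rw [appTop_thickeningPtToOpen_appLE htU n eU (a i), ha i, hvRn i]
  exact (thickeningΓIso T t n).hom_inv_id_apply _

/-- **Step (II) of the proof of Görtz–Wedhorn II, Lemma 24.72, for a fixed `P` with pseudo-coherent
Čech complexes** (the statement of the named fact `isTrivialOver_nhds_of_trivialAlong_thickeningPt` of
`Motives/TheoremOfCubeThickenings` at `P`): over a locally noetherian integral base, if `𝒪(D)` is
trivial along all the thickenings `P ×_K Spec(𝒪_{T,t}/𝔪^{n+1})` of the fibre at `t`, then `D` is
trivial over a neighbourhood of `t`. The proof of
`isTrivialOver_nhds_of_trivialAlong_thickeningPt_of_formalFunctions` (`Motives/TheoremOfCubeFormalLift`):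
compatible trivialisations `τ_n` (Cor. 24.63), a section `s` with `s|_{X_0} = τ_0` (`formalFunctions`),
which generates `𝒪(D)` at a point over `t ∈ Z`, hence over `pr_T⁻¹U` for a neighbourhood `U`.
[cite: GortzWedhorn2023, Lemma 24.72, proof, Step (II) (p. 549)] -/
theorem isTrivialOver_nhds_of_trivialAlong_thickeningPt {P : SchemeOver K} [IsProper P.hom]
    [GeometricallyIntegral P.hom] (hP : CechPseudoCoherentAt P) (T : SchemeOver K)
    [IsIntegral T.left] [IsLocallyNoetherian T.left] [IsIntegral (P ⊗ T).left]
    (D : CartierDivisor (P ⊗ T).left) (t : T.left)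
    (h : ∀ n : ℕ, D.TrivialAlong (P ◁ thickeningPtι T t n).left) :
    ∃ U : T.left.Opens, t ∈ U ∧ D.IsTrivialOver (snd P T).left U := by
  obtain ⟨τ, hτ⟩ := CartierDivisor.exists_isCompatibleFamily_trivialization h
  obtain ⟨U, htU, s, hs, hσ⟩ := hP.formalFunctions T D t (fun n => (τ n).toSectionAlong) hτ 0
  -- a point `x` of `X_0`, its image `w` over `t`, and a chart `U_i ∋ w`
  obtain ⟨x⟩ := nonempty_thickening_left T t P 0
  obtain ⟨i, hi⟩ := D.covers ((P ◁ thickeningPtι T t 0).left x)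
  -- `s|_{X_0} = τ_0` has unit coordinates, so `f_i s` is a unit at `w`
  have hu : IsUnit ((hs.restrictThickening htU 0).σ i) := by
    rw [hσ]; exact (τ 0).isUnit i
  have hw : IsUnitAt ((P ◁ thickeningPtι T t 0).left x) (D.f i * s) :=
    CartierDivisor.isUnitAt_of_isUnit_ofRegular_σ _ _ hu hi
  exact CartierDivisor.isTrivialOver_of_isSectionOver_of_mem_trivialLocus
    (CartierDivisor.mem_trivialLocus_of_trivialAlong_thickeningPt (h 0)) htU hs
    (snd_left_whiskerLeft_thickeningPtι_apply T t P 0 x) ⟨i, hi, hw⟩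

/-! ### Lemma 24.72 for `𝒪(D)` on `(X × Y) × T → T` from `CechPseudoCoherentAt (X ⊗ Y)` -/

variable {X Y : SchemeOver K} [IsProper X.hom] [IsProper Y.hom] [GeometricallyIntegral X.hom]
  [GeometricallyIntegral Y.hom]

/-- **Lemma 24.72 over a locally noetherian integral base, from Step (I) (a theorem of this tree,
`theoremOfCube_trivialAlong_thickeningPt_holds`, `Motives/CubeStepI`) and Step (II) at `X ⊗ Y`**
(Görtz–Wedhorn II, proof of Lemma 24.72, pp. 548–549, as applied in the proof of Thm. 24.73): for
`t ∈ Z` the divisor `D` with trivial slices is trivial over a neighbourhood of `t`.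
[cite: GortzWedhorn2023, Lemma 24.72, proof (pp. 548–549)] -/
theorem isTrivialOver_nhds_locallyNoetherian (hXY : CechPseudoCoherentAt (X ⊗ Y))
    (T : SchemeOver K) [IsIntegral T.left] [IsLocallyNoetherian T.left]
    [IsIntegral ((X ⊗ Y) ⊗ T).left] [IsIntegral (Y ⊗ T).left] [IsIntegral (X ⊗ T).left]
    (x : 𝟙_ (SchemeOver K) ⟶ X) (y : 𝟙_ (SchemeOver K) ⟶ Y) {D : CartierDivisor ((X ⊗ Y) ⊗ T).left}
    (hx : (D.classPullback (((λ_ Y).inv ≫ x ▷ Y) ▷ T).left).LinEquiv 0)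
    (hy : (D.classPullback (((ρ_ X).inv ≫ X ◁ y) ▷ T).left).LinEquiv 0)
    {t : T.left} (ht : t ∈ CartierDivisor.trivialLocus (X ⊗ Y) T D) :
    ∃ U : T.left.Opens, t ∈ U ∧ D.IsTrivialOver (snd (X ⊗ Y) T).left U :=
  hXY.isTrivialOver_nhds_of_trivialAlong_thickeningPt T D t
    (theoremOfCube_trivialAlong_thickeningPt_holds K X Y T x y D hx hy t ht)

/-- **Lemma 24.72 for `𝒪(D)` on `(X × Y) × T → T` over an arbitrary integral base, from
`CechPseudoCoherentAt (X ⊗ Y)`** (the statement of the named fact `theoremOfCube_isTrivialOver_nhds` of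
`Motives/TheoremOfCubeLocal` for these `X`, `Y`): descend around `t ∈ Z` to a base of finite type
(`theoremOfCube_noetherianDescent_holds`, `Motives/TheoremOfCubeLimitProofs`; Görtz–Wedhorn II,
Thm. 23.133, proof, Step (IV)), apply the locally noetherian case, pull back and push along the open
immersion — the proof of `theoremOfCube_isTrivialOver_nhds_of_locallyNoetherian_of_descent`
(`Motives/TheoremOfCubeLimit`). [cite: GortzWedhorn2023, Lemma 24.72 (p. 548), with Thm. 23.133, proof, Step (IV) (p. 479)] -/
theorem isTrivialOver_nhds (hXY : CechPseudoCoherentAt (X ⊗ Y)) (T : SchemeOver K)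
    [IsIntegral T.left] [IsIntegral ((X ⊗ Y) ⊗ T).left] [IsIntegral (Y ⊗ T).left]
    [IsIntegral (X ⊗ T).left] (x : 𝟙_ (SchemeOver K) ⟶ X) (y : 𝟙_ (SchemeOver K) ⟶ Y)
    {D : CartierDivisor ((X ⊗ Y) ⊗ T).left}
    (hx : (D.classPullback (((λ_ Y).inv ≫ x ▷ Y) ▷ T).left).LinEquiv 0)
    (hy : (D.classPullback (((ρ_ X).inv ≫ X ◁ y) ▷ T).left).LinEquiv 0)
    {t : T.left} (ht : t ∈ CartierDivisor.trivialLocus (X ⊗ Y) T D) :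
    ∃ U : T.left.Opens, t ∈ U ∧ D.IsTrivialOver (snd (X ⊗ Y) T).left U := by
  obtain ⟨V, j, hj, t', ht', T₀, hT₀, hT₀', hXYV, hXYT₀, hYT₀, hXT₀, φ, hφ, D₀, hD, hx₀, hy₀, ht₀⟩ :=
    theoremOfCube_noetherianDescent_holds K X Y T x y D hx hy t ht
  haveI : IsLocallyNoetherian T₀.left := LocallyOfFiniteType.isLocallyNoetherian T₀.hom
  -- Lemma 24.72 over the locally noetherian base `T₀` at `φ(t') ∈ Z(D₀)`
  obtain ⟨U₀, hU₀, hD₀⟩ := hXY.isTrivialOver_nhds_locallyNoetherian T₀ x y hx₀ hy₀ ht₀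
  -- pull back along `(X × Y) × φ`: the generic point of `(X × Y) × V` goes to that of `T₀ ∈ U₀`
  haveI : IsDominant ((snd (X ⊗ Y) V).left ≫ φ.left) := inferInstance
  have hη : (snd (X ⊗ Y) T₀).left (((X ⊗ Y) ◁ φ).left (genericPoint ((X ⊗ Y) ⊗ V).left)) ∈ U₀ := by
    rw [snd_left_whiskerLeft_left_apply, ← Scheme.Hom.comp_apply,
      genericPoint_eq_of_isDominant ((snd (X ⊗ Y) V).left ≫ φ.left)]
    exact ((genericPoint_spec T₀.left).mem_open_set_iff U₀.isOpen).2 ⟨_, Set.mem_univ _, hU₀⟩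
  have h3 : (D₀.classPullback ((X ⊗ Y) ◁ φ).left).IsTrivialOver (snd (X ⊗ Y) V).left
      (φ.left ⁻¹ᵁ U₀) :=
    hD₀.classPullback_preimage ((X ⊗ Y) ◁ φ).left φ.left
      (snd_left_whiskerLeft_left_apply (X ⊗ Y) φ) hη
  -- push along the open immersion `(X × Y) × j`
  have h4 : (D.classPullback ((X ⊗ Y) ◁ j).left).IsTrivialOver (snd (X ⊗ Y) V).left
      (φ.left ⁻¹ᵁ U₀) :=
    hD.symm.isTrivialOver h3
  exact ⟨j.left ''ᵁ (φ.left ⁻¹ᵁ U₀), ⟨t', hU₀, ht'⟩,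
    CartierDivisor.IsTrivialOver.of_classPullback_whiskerLeft (X ⊗ Y) j h4⟩

/-- **The conclusion of Lemma 24.72 for `𝒪(D)` on `(X × Y) × T → T` from `CechPseudoCoherentAt (X ⊗ Y)`**
(the statement of the named fact `theoremOfCube_exists_isSectionOver` of `Motives/TheoremOfCubeLift`
for these `X`, `Y`): around `t ∈ Z` a section of `𝒪(D)` over some `pr_T⁻¹U` generating it at a point
over `t` (a local equation of the trivial `D|_{pr_T⁻¹U}`, `IsTrivialOver.exists_isSectionOver`).
[cite: GortzWedhorn2023, Lemma 24.72, proof, Step (II) (p. 549)] -/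
theorem exists_isSectionOver (hXY : CechPseudoCoherentAt (X ⊗ Y)) (T : SchemeOver K)
    [IsIntegral T.left] [IsIntegral ((X ⊗ Y) ⊗ T).left] [IsIntegral (Y ⊗ T).left]
    [IsIntegral (X ⊗ T).left] (x : 𝟙_ (SchemeOver K) ⟶ X) (y : 𝟙_ (SchemeOver K) ⟶ Y)
    {D : CartierDivisor ((X ⊗ Y) ⊗ T).left}
    (hx : (D.classPullback (((λ_ Y).inv ≫ x ▷ Y) ▷ T).left).LinEquiv 0)
    (hy : (D.classPullback (((ρ_ X).inv ≫ X ◁ y) ▷ T).left).LinEquiv 0)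
    {t : T.left} (ht : t ∈ CartierDivisor.trivialLocus (X ⊗ Y) T D) :
    ∃ (U : T.left.Opens) (s : ((X ⊗ Y) ⊗ T).left.functionField), t ∈ U ∧
      D.IsSectionOver (snd (X ⊗ Y) T).left U s ∧
      ∃ w : ((X ⊗ Y) ⊗ T).left, (snd (X ⊗ Y) T).left w = t ∧ w ∈ D.nonvanishing s := by
  obtain ⟨U, htU, hU⟩ := hXY.isTrivialOver_nhds T x y hx hy ht
  obtain ⟨s, hs, hnv⟩ := hU.exists_isSectionOver
  obtain ⟨w, hw⟩ := (snd (X ⊗ Y) T).left.surjective t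
  exact ⟨U, s, htU, hs, w, hw, hnv w (hw ▸ htU)⟩

/-- **Openness of the trivial locus in the cube situation from `CechPseudoCoherentAt (X ⊗ Y)`**
(Görtz–Wedhorn II, Lemma 24.72: "In particular, `U → S` factors through `Z → S`"; the statement of
the named fact `theoremOfCube_isOpen_trivialLocus` of `Motives/SeesawTheorem` for these `X`, `Y`). The
proof of `theoremOfCube_isOpen_trivialLocus_of_isTrivialOver_nhds` (`Motives/TheoremOfCubeLocal`).
[cite: GortzWedhorn2023, Lemma 24.72 (p. 548) and proof of Thm. 24.73 (p. 550)] -/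
theorem isOpen_trivialLocus (hXY : CechPseudoCoherentAt (X ⊗ Y)) (T : SchemeOver K)
    [IsIntegral T.left] [IsIntegral ((X ⊗ Y) ⊗ T).left] [IsIntegral (Y ⊗ T).left]
    [IsIntegral (X ⊗ T).left] (x : 𝟙_ (SchemeOver K) ⟶ X) (y : 𝟙_ (SchemeOver K) ⟶ Y)
    {D : CartierDivisor ((X ⊗ Y) ⊗ T).left}
    (hx : (D.classPullback (((λ_ Y).inv ≫ x ▷ Y) ▷ T).left).LinEquiv 0)
    (hy : (D.classPullback (((ρ_ X).inv ≫ X ◁ y) ▷ T).left).LinEquiv 0) :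
    IsOpen (CartierDivisor.trivialLocus (X ⊗ Y) T D) := by
  rw [isOpen_iff_forall_mem_open]
  intro t ht
  obtain ⟨U, htU, hU⟩ := hXY.isTrivialOver_nhds T x y hx hy ht
  refine ⟨U, fun t' ht' => ?_, U.isOpen, htU⟩
  rw [CartierDivisor.mem_trivialLocus_iff]
  refine hU.classPullback_linEquiv_zero _ fun q => ?_
  rw [snd_left_whiskerLeft_residuePtι_apply]
  exact ht'

end CechPseudoCoherentAt

/-! ### The Theorem of the Cube for `(X, Y, T)` from `CechPseudoCoherentAt (X ⊗ Y)` -/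

/-- **The Theorem of the Cube (Görtz–Wedhorn II, Thm. 24.73 over a field, divisor form; the statement
of the named fact `theoremOfCube_linEquiv` of `Motives/AbelianVarietyTheoremOfCube` for these `X`, `Y`)
from the pseudo-coherence of the Čech complexes of the `𝒪(D)` on the base changes of `X ×_K Y`
alone.** The proof of `theoremOfCube_linEquiv_of_seesaw` (`Motives/AbelianVarietyTheoremOfCubeProofs`,
along the printed proof, p. 550): the trivial locus of `D' = α^*D` on `(X × Y) × T` is open
(`CechPseudoCoherentAt.isOpen_trivialLocus`, Lemma 24.72), closed
(`CechPseudoCoherentAt.isClosed_trivialLocus`, Thm. 24.66 (3) at `X ⊗ Y`) and contains the point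
under `t₀`, hence is all of the irreducible `T`; so `D' ∼ pr_T^*M`
(`CechPseudoCoherentAt.exists_linEquiv_classPullback_snd`, Thm. 24.66 at `X ⊗ Y`), and `M ∼ 0` by
restriction along `{x} × Y × T` and the section `{y} × T`.
[cite: GortzWedhorn2023, Thm. 24.73, proof (p. 550)] -/
theorem theoremOfCube_linEquiv_of_cechPseudoCoherentAt {X Y : SchemeOver K} [IsProper X.hom]
    [IsProper Y.hom] [GeometricallyIntegral X.hom] [GeometricallyIntegral Y.hom]
    (hXY : CechPseudoCoherentAt (X ⊗ Y)) (T : SchemeOver K) [IsIntegral T.left]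
    [IsIntegral (X ⊗ (Y ⊗ T)).left] [IsIntegral (Y ⊗ T).left] [IsIntegral (X ⊗ T).left]
    [IsIntegral (X ⊗ Y).left]
    (x : 𝟙_ (SchemeOver K) ⟶ X) (y : 𝟙_ (SchemeOver K) ⟶ Y) (t₀ : 𝟙_ (SchemeOver K) ⟶ T)
    (D : CartierDivisor (X ⊗ (Y ⊗ T)).left)
    (hx : (D.classPullback ((λ_ (Y ⊗ T)).inv ≫ x ▷ (Y ⊗ T)).left).LinEquiv 0)
    (hy : (D.classPullback (X ◁ ((λ_ T).inv ≫ y ▷ T)).left).LinEquiv 0)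
    (ht : (D.classPullback (X ◁ ((ρ_ Y).inv ≫ Y ◁ t₀)).left).LinEquiv 0) :
    D.LinEquiv 0 := by
  -- `(X × Y) × T ≅ X × (Y × T)` is integral
  haveI : IsIntegral ((X ⊗ Y) ⊗ T).left := IsIntegral.of_isIso (α_ X Y T).inv.left
  -- the transported divisor `D' = α^* D` and its two trivial slices
  have hx' : ((D.classPullback (α_ X Y T).hom.left).classPullback
      (((λ_ Y).inv ≫ x ▷ Y) ▷ T).left).LinEquiv 0 := by
    refine (D.classPullback_comp_linEquiv (α_ X Y T).hom.left _).symm.trans ?_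
    rw [← Over.comp_left, whiskerRight_sliceLeft_comp_associator]
    exact hx
  have hy' : ((D.classPullback (α_ X Y T).hom.left).classPullback
      (((ρ_ X).inv ≫ X ◁ y) ▷ T).left).LinEquiv 0 := by
    refine (D.classPullback_comp_linEquiv (α_ X Y T).hom.left _).symm.trans ?_
    rw [← Over.comp_left, whiskerRight_sliceRight_comp_associator]
    exact hy
  -- its trivial locus is open (cube, local form), closed (seesaw) and contains `t₀`
  have hU : IsOpen (CartierDivisor.trivialLocus (X ⊗ Y) T (D.classPullback (α_ X Y T).hom.left)) :=
    hXY.isOpen_trivialLocus T x y hx' hy'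
  have hZ : IsClosed (CartierDivisor.trivialLocus (X ⊗ Y) T
      (D.classPullback (α_ X Y T).hom.left)) :=
    hXY.isClosed_trivialLocus T _
  have hs : Nonempty (𝟙_ (SchemeOver K)).left := inferInstanceAs (Nonempty (Spec (.of K)))
  obtain ⟨s⟩ := hs
  have hp : t₀.left s ∈ CartierDivisor.trivialLocus (X ⊗ Y) T
      (D.classPullback (α_ X Y T).hom.left) := by
    rw [CartierDivisor.mem_trivialLocus_iff]
    refine (D.classPullback_comp_linEquiv (α_ X Y T).hom.left _).symm.trans ?_
    rw [← Over.comp_left, whiskerLeft_residuePtι_comp_associator, Over.comp_left]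
    exact (D.classPullback_comp_linEquiv _ _).trans (ht.classPullback_zero _)
  -- `T` is irreducible, hence connected: every fibre is trivial
  have huniv : CartierDivisor.trivialLocus (X ⊗ Y) T (D.classPullback (α_ X Y T).hom.left) =
      Set.univ :=
    IsClopen.eq_univ ⟨hZ, hU⟩ ⟨_, hp⟩
  -- seesaw: `D' ∼ pr_T^* M`
  obtain ⟨M, hM⟩ := hXY.exists_linEquiv_classPullback_snd T (D.classPullback (α_ X Y T).hom.left)
    (fun t => by rw [huniv]; exact Set.mem_univ t)
  -- `pr_T^* M ∼ 0` on `{x} × Y × T = Y × T`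
  have e1 : (((λ_ Y).inv ≫ x ▷ Y) ▷ T) ≫ snd (X ⊗ Y) T = snd Y T := by simp
  have h1 : (M.classPullback (snd Y T).left).LinEquiv 0 := by
    have h := M.classPullback_comp_linEquiv (snd (X ⊗ Y) T).left (((λ_ Y).inv ≫ x ▷ Y) ▷ T).left
    rw [← Over.comp_left, e1] at h
    exact h.trans ((hM.classPullback _).symm.trans hx')
  -- `M ∼ 0` by restriction along the section `T = {y} × T → Y × T`
  have e2 : ((λ_ T).inv ≫ y ▷ T) ≫ snd Y T = 𝟙 T := by simp
  have h2 : M.LinEquiv 0 := by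
    have h := M.classPullback_comp_linEquiv (snd Y T).left ((λ_ T).inv ≫ y ▷ T).left
    rw [← Over.comp_left, e2, Over.id_left] at h
    exact (M.classPullback_id_linEquiv.symm.trans h).trans (h1.classPullback_zero _)
  -- hence `D' ∼ 0` and `D ∼ (α⁻¹)^* D' ∼ 0`
  have h3 : (D.classPullback (α_ X Y T).hom.left).LinEquiv 0 := hM.trans (h2.classPullback_zero _)
  have e3 : (α_ X Y T).inv ≫ (α_ X Y T).hom = 𝟙 _ := Iso.inv_hom_id _
  have h4 := D.classPullback_comp_linEquiv (α_ X Y T).hom.left (α_ X Y T).inv.left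
  rw [← Over.comp_left, e3, Over.id_left] at h4
  exact (D.classPullback_id_linEquiv.symm.trans h4).trans (h3.classPullback_zero _)

/-! ### Consequences for an abelian variety `A` from `CechPseudoCoherentAt (A ⊗ A)` -/

namespace AbelianVariety

variable (A : AbelianVariety K)

open scoped MonObj

/-- **The cubical structure of an abelian variety (Görtz–Wedhorn II, Prop. 27.167) from the
pseudo-coherence of the Čech complexes of the `𝒪(D)` on the base changes of `A × A`** (the statement
of the named fact `AbelianVariety.cubicalStructure_linEquiv A`). The proof of
`AbelianVariety.cubicalStructure_linEquiv_of_theoremOfCube` (`Motives/AbelianVarietyTheoremOfCube`,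
following the printed proof, pp. 877–878), the theorem of the cube being applied only to
`(X, Y, T) = (A, A, A)` (`theoremOfCube_linEquiv_of_cechPseudoCoherentAt`): in the universal case the
cube divisor restricts trivially to the three coordinate slices, and the general case is a class
pullback along `(x₁, x₂, x₃) : T → A × A × A`.
[cite: GortzWedhorn2023, Prop. 27.167, proof (pp. 877–878)] -/
theorem cubicalStructure_linEquiv_of_cechPseudoCoherentAt (h : CechPseudoCoherentAt (A.X ⊗ A.X)) :
    A.cubicalStructure_linEquiv := by
  rw [cubicalStructure_linEquiv_iff]
  intro T _ x₁ x₂ x₃ D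
  -- the universal case
  let p₁ : A.X ⊗ (A.X ⊗ A.X) ⟶ A.X := CartesianMonoidalCategory.fst _ _
  let p₂ : A.X ⊗ (A.X ⊗ A.X) ⟶ A.X := CartesianMonoidalCategory.snd _ _ ≫ CartesianMonoidalCategory.fst _ _
  let p₃ : A.X ⊗ (A.X ⊗ A.X) ⟶ A.X := CartesianMonoidalCategory.snd _ _ ≫ CartesianMonoidalCategory.snd _ _
  have huniv : (cubePos D p₁ p₂ p₃).LinEquiv (cubeNeg D p₁ p₂ p₃) := by
    apply CartierDivisor.LinEquiv.of_add_neg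
    refine theoremOfCube_linEquiv_of_cechPseudoCoherentAt h A.X η η η _ ?_ ?_ ?_
    · -- slice `{0} × A × A`
      apply classPullback_cubePos_add_neg_linEquiv_zero
      have e1 : ((λ_ (A.X ⊗ A.X)).inv ≫ η ▷ (A.X ⊗ A.X)) ≫ p₁ = 1 := by
        simp only [p₁, Category.assoc, whiskerRight_fst, leftUnitor_inv_fst_assoc]; rfl
      have e2 : ((λ_ (A.X ⊗ A.X)).inv ≫ η ▷ (A.X ⊗ A.X)) ≫ p₂ = CartesianMonoidalCategory.fst _ _ := by
        simp only [p₂, Category.assoc, whiskerRight_snd_assoc, leftUnitor_inv_snd_assoc]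
      have e3 : ((λ_ (A.X ⊗ A.X)).inv ≫ η ▷ (A.X ⊗ A.X)) ≫ p₃ = CartesianMonoidalCategory.snd _ _ := by
        simp only [p₃, Category.assoc, whiskerRight_snd_assoc, leftUnitor_inv_snd_assoc]
      rw [e1, e2, e3]
      exact cubePos_one_left_linEquiv D _ _
    · -- slice `A × {0} × A`
      apply classPullback_cubePos_add_neg_linEquiv_zero
      have e1 : (A.X ◁ ((λ_ A.X).inv ≫ η ▷ A.X)) ≫ p₁ = CartesianMonoidalCategory.fst _ _ := by
        simp only [p₁, whiskerLeft_fst]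
      have e2 : (A.X ◁ ((λ_ A.X).inv ≫ η ▷ A.X)) ≫ p₂ = 1 := by
        simp only [p₂, whiskerLeft_snd_assoc, Category.assoc, whiskerRight_fst,
          leftUnitor_inv_fst_assoc]
        rw [Hom.one_def, ← Category.assoc, comp_toUnit]
      have e3 : (A.X ◁ ((λ_ A.X).inv ≫ η ▷ A.X)) ≫ p₃ = CartesianMonoidalCategory.snd _ _ := by
        simp only [p₃, whiskerLeft_snd_assoc, Category.assoc, whiskerRight_snd,
          leftUnitor_inv_snd, Category.comp_id]
      rw [e1, e2, e3]
      exact cubePos_one_mid_linEquiv D _ _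
    · -- slice `A × A × {0}`
      apply classPullback_cubePos_add_neg_linEquiv_zero
      have e1 : (A.X ◁ ((ρ_ A.X).inv ≫ A.X ◁ η)) ≫ p₁ = CartesianMonoidalCategory.fst _ _ := by
        simp only [p₁, whiskerLeft_fst]
      have e2 : (A.X ◁ ((ρ_ A.X).inv ≫ A.X ◁ η)) ≫ p₂ = CartesianMonoidalCategory.snd _ _ := by
        simp only [p₂, whiskerLeft_snd_assoc, Category.assoc, whiskerLeft_fst,
          rightUnitor_inv_fst, Category.comp_id]
      have e3 : (A.X ◁ ((ρ_ A.X).inv ≫ A.X ◁ η)) ≫ p₃ = 1 := by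
        simp only [p₃, whiskerLeft_snd_assoc, Category.assoc, whiskerLeft_snd,
          rightUnitor_inv_snd_assoc]
        rw [Hom.one_def, ← Category.assoc, comp_toUnit]
      rw [e1, e2, e3]
      exact cubePos_one_right_linEquiv D _ _
  -- pull back along `(x₁, x₂, x₃)`
  obtain ⟨h1, h2, h3⟩ := A.lift_lift_comp_proj x₁ x₂ x₃
  have hc := (cubePos_comp_linEquiv (lift x₁ (lift x₂ x₃)) D p₁ p₂ p₃).trans
    ((huniv.classPullback _).trans (cubeNeg_comp_linEquiv (lift x₁ (lift x₂ x₃)) D p₁ p₂ p₃).symm)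
  simp only [p₁, p₂, p₃] at hc
  rw [h1, h2, h3] at hc
  exact hc

/-- **`[n]^*D ∼ ((n²+n)/2) D + ((n²−n)/2) [-1]^*D` for an abelian variety `A` (Görtz–Wedhorn II,
Prop. 27.184 (1) with Rem. 27.185; the statement of the named fact
`AbelianVariety.pullback_zsmul_id_linEquiv A`) from the pseudo-coherence of the Čech complexes of the
`𝒪(D)` on the base changes of `A × A`** (through the cubical structure,
`pullback_zsmul_id_linEquiv_of_cubicalStructure` of `Motives/AbelianVarietyCube`).
[cite: GortzWedhorn2023, Prop. 27.184 (1) and Rem. 27.185 (p. 886)] -/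
theorem pullback_zsmul_id_linEquiv_of_cechPseudoCoherentAt (h : CechPseudoCoherentAt (A.X ⊗ A.X)) :
    A.pullback_zsmul_id_linEquiv :=
  A.pullback_zsmul_id_linEquiv_of_cubicalStructure (A.cubicalStructure_linEquiv_of_cechPseudoCoherentAt h)

/-- **`[n]^*D ∼ ((n²+n)/2) D + ((n²−n)/2) [-1]^*D` for an abelian variety `A` from the finiteness of
the Čech cohomology of the line bundles `𝒪(D₀)` on `(A × A) ×_K T₀`, for ONE Čech cover each**, for
all affine integral `T₀` of finite type over `K` and all Cartier divisors `D₀` on the integral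
`(A × A) ×_K T₀` (`cechPseudoCoherentAt_of_exists_cechCover`: cover independence, Görtz–Wedhorn II,
Thm. 22.9, finite free resolutions over noetherian rings, Prop. 21.162, and noetherian approximation,
Thm. 23.133, Step (IV)). Since `A × A` is projective over `K` (`AbelianVariety.isProjectiveOver_holds`
and the Segre embedding), the remaining hypothesis is Serre's finiteness theorem for these line
bundles on the closed subscheme `(A × A) ×_K T₀` of `𝐏ⁿ_{T₀}` (Görtz–Wedhorn II, Thm. 23.4;
Hartshorne III Thm. 5.2 (a)) — not the finiteness theorem for proper morphisms.
[cite: GortzWedhorn2023, Prop. 27.184 (1) (p. 886), via Thm. 23.133, proof (pp. 478–479) and Thm. 22.9 (p. 332)] -/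
theorem pullback_zsmul_id_linEquiv_of_finite_cechCohomology
    (h : ∀ (T : SchemeOver K) [IsAffine T.left] [IsIntegral T.left] [LocallyOfFiniteType T.hom]
      [IsNoetherianRing Γ(T.left, ⊤)] [IsIntegral ((A.X ⊗ A.X) ⊗ T).left]
      (D : CartierDivisor ((A.X ⊗ A.X) ⊗ T).left),
      ∃ 𝔚 : CartierDivisor.CechCover (CartesianMonoidalCategory.snd (A.X ⊗ A.X) T).left ⊤ D,
        ∀ n : ℤ, Module.Finite Γ(T.left, ⊤) (𝔚.complex.homology n)) :
    A.pullback_zsmul_id_linEquiv :=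
  A.pullback_zsmul_id_linEquiv_of_cechPseudoCoherentAt
    (cechPseudoCoherentAt_of_exists_cechCover (A.X ⊗ A.X) fun T _ _ _ _ _ D => h T D)

end AbelianVariety

end Literature.AlgebraicGeometry.Motives

end
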